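import Summits.ResolutionOfSingularities.ResolutionOfSingularities.Theorems.HomologicalConductorSurfaceTerminationPrintDebtDoorsMeet
import HarnessLib

/-!
# Kill test `SurfaceTermination` (stmt-ResolutionOfSingularities-16488): the genus-descent residue is EQUIVALENT to the
# kill test modulo the three prints — converse doors

Route `ResolutionOfSingularities/HomologicalConductor`.  OURS (hand leafhand-res-homologicalconduct-20 g2, 2026-08-31);
nothing here is a statement of the manuscript under review (Hironaka 2017); AI-written, weaker than expert review.

Hand 20 g1 (`…PrintDebtDoorsThree`, p831962; `…PrintDebtDoorsMeet`, p832476) reduced the kill test to THREE prints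
{`CossartJannsenSaito2020General`, `Lipman1969_4_1`, `Lipman1969_12_1_ii`} plus ONE residue, in two consumed forms:

* (G) «no eternal positive constant geometric genus along a prime divisor»: along a prime divisor `O` of `K/k` the
  stages `T_(m'+1)` of the canonical normalised `ca`-tower do not have geometric genus exactly `g + 1 ≥ 1` for all
  `m' ≥ m` (`surfaceTermination_of_prints3_of_noEternalGenus`);
* (M) the MEET form: eternal positive constant genus together with capture failing at cofinally many singular
  non-rational stages is impossible (`surfaceTermination_of_prints3_of_meet`).

This file records the CONVERSES, all FACT-FREE: a regular stage is terminal (`isRegularLocalRing_tower_of_le`) and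
rational (`hasRationalSingularity_of_isRegularLocalRing`), hence of genus `0 ≤ g`; so termination along a prime divisor
forbids an eternal positive genus, and (M) is a weakening of (G).

* `noEternalGenus_of_primeDivisorSurfaceTermination` — (D-s) ⇒ (G);
* `noEternalGenus_of_surfaceTermination` — `SurfaceTermination` ⇒ (G);
* `meet_of_noEternalGenus` — (G) ⇒ (M), hence `meet_of_surfaceTermination`;
* `primeDivisorSurfaceTermination_iff_noEternalGenus_of_prints3`, `surfaceTermination_iff_noEternalGenus_of_prints3`,
  `surfaceTermination_iff_meet_of_prints3` — modulo the three prints, (G), (M), (D-s) and the kill test are EQUIVALENT.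

Reading for the planner (repair census of 16488): the genus-descent line does not replace the kill test by a weaker
statement — its residue is a NORMAL FORM of the kill test (all failure of termination is an eternal positive constant
genus along a prime divisor, at non-rational stages, with capture failing cofinally often); the three prints are the
whole difference between the residue and `SurfaceTermination` BY NAME.  No new definitions; no named-fact hypothesis in
the fact-free doors.  No crux, kill test or summit statement is proved here; resolution of singularities in positive
characteristic is NOT proved.

References: J. Lipman, Publ. Math. IHÉS 36 (1969), (1.1), (4.1), (12.1) [`Lipman1969`]; V. Cossart, U. Jannsen,
S. Saito (2020), Thm. 1.2 [`CossartJannsenSaito2020`].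
-/

set_option linter.dupNamespace false

noncomputable section

namespace Summit.ResolutionOfSingularities.ResolutionOfSingularities.Theorems.SurfaceTermination.PrintDebtDoors

open Summit.ResolutionOfSingularities.ResolutionOfSingularities.Theses.HomologicalConductor (SurfaceTermination)
open Summit.ResolutionOfSingularities.ResolutionOfSingularities.Theorems
open Summit.ResolutionOfSingularities.ResolutionOfSingularities.Theorems.NoZeno.Birth
open Summit.ResolutionOfSingularities.ResolutionOfSingularities.Theorems.NoZeno.SandwichCluster
open Summit.ResolutionOfSingularities.ResolutionOfSingularities.Theorems.SurfaceTermination.GenusDescent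
open Summit.ResolutionOfSingularities.ResolutionOfSingularities.Theorems.SurfaceTermination.Descent
open Summit.ResolutionOfSingularities.ResolutionOfSingularities.Theorems.SurfaceTermination.Reduction
open Literature.AlgebraicGeometry.Resolution Literature.AlgebraicGeometry.Morphisms
open Literature.RingTheory.CohomologyAnnihilator (cohomologyAnnihilator)
open CategoryTheory AlgebraicGeometry

variable {k K : Type} [Field k] [Field K] [Algebra k K]

/-! ## A regular stage forbids an eternal positive genus (fact-free) -/

/-- **A regular stage forbids an eternal positive constant genus** (fact-free, any valuation ring `O ∋ k`): if some
stage `T_m₀` of the canonical tower is a regular local ring, then it is impossible that the stages `T_(m'+1)`,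
`m' ≥ m`, all have geometric genus exactly `g + 1` — the stage `T_(m₀+m+1)` is regular (regular stages are terminal,
`isRegularLocalRing_tower_of_le`), hence rational (`hasRationalSingularity_of_isRegularLocalRing`), i.e. of genus
`≤ 0 ≤ g`.  The pattern is the `no_regular` step of `primeDivisorSurfaceTermination_of_prints3_of_meet`, isolated.
[cite: Lipman1969, Definition (1.1) (p. 199)] -/
theorem false_of_constantGenus_of_isRegularLocalRing (O : ValuationSubring K) (A : Subalgebra k K)
    (hk : ∀ c : k, algebraMap k K c ∈ O) (hfr : IsFractionRing ↥A K) (hAO : A.toSubring ≤ O.toSubring)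
    {m₀ : ℕ} (hreg : IsRegularLocalRing ↥(tower O A m₀)) (g m : ℕ)
    (hconst : ∀ m' : ℕ, m ≤ m' →
      HasGeometricGenusLE ↥(tower O A (m' + 1)) (g + 1) ∧ ¬ HasGeometricGenusLE ↥(tower O A (m' + 1)) g) :
    False := by
  have hreg' : IsRegularLocalRing ↥(tower O A (m₀ + m + 1)) :=
    isRegularLocalRing_tower_of_le O A hk hfr hAO (by omega) hreg
  have hrat : HasRationalSingularity ↥(tower O A (m₀ + m + 1)) := by
    haveI := hreg'
    exact hasRationalSingularity_of_isRegularLocalRing _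
  exact (hconst (m₀ + m) (Nat.le_add_left m m₀)).2
    (hasGeometricGenusLE_mono (Nat.zero_le g) ((hasGeometricGenusLE_zero_iff _).mpr hrat))

/-- **(D-s) ⇒ (G)**: the prime-divisor case of the kill test implies «no eternal positive constant geometric genus
along a prime divisor» — the residue consumed by `primeDivisorSurfaceTermination_of_prints3_of_noEternalGenus`,
VERBATIM.  Fact-free. [this work] -/
theorem noEternalGenus_of_primeDivisorSurfaceTermination (h : PrimeDivisorSurfaceTermination) :
    ∀ p : ℕ, p.Prime → ∀ (k K : Type) [Field k] [CharP k p] [Field K] [Algebra k K]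
      (O : ValuationSubring K) (A : Subalgebra k K) (hk : ∀ c : k, algebraMap k K c ∈ O), A.FG →
      IsFractionRing ↥A K → A.toSubring ≤ O.toSubring → ringKrullDim ↥A = 2 →
      O ≠ ⊤ → IsDiscreteValuationRing ↥O → residueTrdeg k O hk + 1 = Algebra.trdeg k K →
      ∀ g m : ℕ, (∀ m' : ℕ, m ≤ m' →
        HasGeometricGenusLE ↥(tower O A (m' + 1)) (g + 1) ∧ ¬ HasGeometricGenusLE ↥(tower O A (m' + 1)) g) →
        False := by
  intro p hp k K _ _ _ _ O A hk hA hfr hAO hdim hOtop hdvr hres g m hconst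
  have hterm : ∃ m₀ : ℕ, IsRegularLocalRing ↥(tower O A m₀) :=
    (primeDivisorSurfaceTermination_iff_tower.mp h) p hp k K O A hk hA hfr hAO hdim hOtop hdvr hres
  obtain ⟨m₀, hreg⟩ := hterm
  exact false_of_constantGenus_of_isRegularLocalRing O A hk hfr hAO hreg g m hconst

/-- **`SurfaceTermination` ⇒ (G)**: the kill test implies «no eternal positive constant geometric genus along a prime
divisor» (through its prime-divisor case, `primeDivisorSurfaceTermination_of_surfaceTermination`).  Fact-free.
[this work] -/
theorem noEternalGenus_of_surfaceTermination (h : SurfaceTermination) :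
    ∀ p : ℕ, p.Prime → ∀ (k K : Type) [Field k] [CharP k p] [Field K] [Algebra k K]
      (O : ValuationSubring K) (A : Subalgebra k K) (hk : ∀ c : k, algebraMap k K c ∈ O), A.FG →
      IsFractionRing ↥A K → A.toSubring ≤ O.toSubring → ringKrullDim ↥A = 2 →
      O ≠ ⊤ → IsDiscreteValuationRing ↥O → residueTrdeg k O hk + 1 = Algebra.trdeg k K →
      ∀ g m : ℕ, (∀ m' : ℕ, m ≤ m' →
        HasGeometricGenusLE ↥(tower O A (m' + 1)) (g + 1) ∧ ¬ HasGeometricGenusLE ↥(tower O A (m' + 1)) g) →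
        False :=
  noEternalGenus_of_primeDivisorSurfaceTermination (primeDivisorSurfaceTermination_of_surfaceTermination h)

/-! ## (G) ⇒ (M): the meet residue is a weakening of the genus residue -/

/-- **(G) ⇒ (M)**: «no eternal positive constant genus» implies the MEET residue of
`primeDivisorSurfaceTermination_of_prints3_of_meet` VERBATIM (its extra hypothesis — capture failing at cofinally many
singular non-rational stages — is simply not used).  Fact-free. [this work] -/
theorem meet_of_noEternalGenus
    (hG : ∀ p : ℕ, p.Prime → ∀ (k K : Type) [Field k] [CharP k p] [Field K] [Algebra k K]
      (O : ValuationSubring K) (A : Subalgebra k K) (hk : ∀ c : k, algebraMap k K c ∈ O), A.FG →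
      IsFractionRing ↥A K → A.toSubring ≤ O.toSubring → ringKrullDim ↥A = 2 →
      O ≠ ⊤ → IsDiscreteValuationRing ↥O → residueTrdeg k O hk + 1 = Algebra.trdeg k K →
      ∀ g m : ℕ, (∀ m' : ℕ, m ≤ m' →
        HasGeometricGenusLE ↥(tower O A (m' + 1)) (g + 1) ∧ ¬ HasGeometricGenusLE ↥(tower O A (m' + 1)) g) →
        False) :
    ∀ p : ℕ, p.Prime → ∀ (k K : Type) [Field k] [CharP k p] [Field K] [Algebra k K]
      (O : ValuationSubring K) (A : Subalgebra k K) (hk : ∀ c : k, algebraMap k K c ∈ O), A.FG →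
      IsFractionRing ↥A K → A.toSubring ≤ O.toSubring → ringKrullDim ↥A = 2 →
      O ≠ ⊤ → IsDiscreteValuationRing ↥O → residueTrdeg k O hk + 1 = Algebra.trdeg k K →
      ∀ g m : ℕ, (∀ m' : ℕ, m ≤ m' →
        HasGeometricGenusLE ↥(tower O A (m' + 1)) (g + 1) ∧ ¬ HasGeometricGenusLE ↥(tower O A (m' + 1)) g) →
        (∀ m₁ : ℕ, ∃ i : ℕ, m₁ + 1 ≤ i ∧ ¬ IsRegularLocalRing ↥(tower O A i) ∧
          ¬ HasRationalSingularity ↥(tower O A i) ∧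
          ∃ (S : Subalgebra k K) (hTS : tower O A i ≤ S),
            (∀ t ∈ tower O A i, t⁻¹ ∈ S → t⁻¹ ∈ tower O A i) ∧ IsRegularLocalRing ↥S ∧
            Algebra.EssFiniteType k ↥S ∧
            ¬ (Ideal.map (Subalgebra.inclusion hTS).toRingHom (cohomologyAnnihilator ↥(tower O A i))).IsPrincipal) →
        False := by
  intro p hp k K _ _ _ _ O A hk hA hfr hAO hdim hOtop hdvr hres g m hconst _
  exact hG p hp k K O A hk hA hfr hAO hdim hOtop hdvr hres g m hconst

/-- **`SurfaceTermination` ⇒ (M)**: the kill test implies the meet residue.  Fact-free. [this work] -/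
theorem meet_of_surfaceTermination (h : SurfaceTermination) :
    ∀ p : ℕ, p.Prime → ∀ (k K : Type) [Field k] [CharP k p] [Field K] [Algebra k K]
      (O : ValuationSubring K) (A : Subalgebra k K) (hk : ∀ c : k, algebraMap k K c ∈ O), A.FG →
      IsFractionRing ↥A K → A.toSubring ≤ O.toSubring → ringKrullDim ↥A = 2 →
      O ≠ ⊤ → IsDiscreteValuationRing ↥O → residueTrdeg k O hk + 1 = Algebra.trdeg k K →
      ∀ g m : ℕ, (∀ m' : ℕ, m ≤ m' →
        HasGeometricGenusLE ↥(tower O A (m' + 1)) (g + 1) ∧ ¬ HasGeometricGenusLE ↥(tower O A (m' + 1)) g) →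
        (∀ m₁ : ℕ, ∃ i : ℕ, m₁ + 1 ≤ i ∧ ¬ IsRegularLocalRing ↥(tower O A i) ∧
          ¬ HasRationalSingularity ↥(tower O A i) ∧
          ∃ (S : Subalgebra k K) (hTS : tower O A i ≤ S),
            (∀ t ∈ tower O A i, t⁻¹ ∈ S → t⁻¹ ∈ tower O A i) ∧ IsRegularLocalRing ↥S ∧
            Algebra.EssFiniteType k ↥S ∧
            ¬ (Ideal.map (Subalgebra.inclusion hTS).toRingHom (cohomologyAnnihilator ↥(tower O A i))).IsPrincipal) →
        False :=
  meet_of_noEternalGenus (noEternalGenus_of_surfaceTermination h)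

/-! ## Modulo the three prints: residue ⟺ kill test -/

/-- **(D-s) ⟺ (G) modulo the three prints** {CJS 2020 Thm 1.2, Lipman (4.1), Lipman (12.1)(ii)}: the prime-divisor
case of the kill test is EQUIVALENT to «no eternal positive constant genus along a prime divisor» (⇒ fact-free;
⇐ `primeDivisorSurfaceTermination_of_prints3_of_noEternalGenus`). [cite: CossartJannsenSaito2020, Thm. 1.2]
[cite: Lipman1969, Theorem (4.1) (p. 204) and Theorem (12.1) (ii) (p. 220)] -/
theorem primeDivisorSurfaceTermination_iff_noEternalGenus_of_prints3
    (hCJS : CossartJannsenSaito2020General.{0}) (h41 : Lipman1969_4_1.{0}) (h12ii : Lipman1969_12_1_ii.{0}) :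
    PrimeDivisorSurfaceTermination ↔
      ∀ p : ℕ, p.Prime → ∀ (k K : Type) [Field k] [CharP k p] [Field K] [Algebra k K]
        (O : ValuationSubring K) (A : Subalgebra k K) (hk : ∀ c : k, algebraMap k K c ∈ O), A.FG →
        IsFractionRing ↥A K → A.toSubring ≤ O.toSubring → ringKrullDim ↥A = 2 →
        O ≠ ⊤ → IsDiscreteValuationRing ↥O → residueTrdeg k O hk + 1 = Algebra.trdeg k K →
        ∀ g m : ℕ, (∀ m' : ℕ, m ≤ m' →
          HasGeometricGenusLE ↥(tower O A (m' + 1)) (g + 1) ∧ ¬ HasGeometricGenusLE ↥(tower O A (m' + 1)) g) →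
          False :=
  ⟨noEternalGenus_of_primeDivisorSurfaceTermination,
    primeDivisorSurfaceTermination_of_prints3_of_noEternalGenus hCJS h41 h12ii⟩

/-- **`SurfaceTermination` ⟺ (G) modulo the three prints**: the kill test BY NAME is EQUIVALENT to «no eternal positive
constant geometric genus along a prime divisor» (⇒ fact-free; ⇐ `surfaceTermination_of_prints3_of_noEternalGenus`,
which also spends the prints on the reduction to the prime-divisor case).  So the residue of the genus-descent line of
16488 is a normal form of the kill test, not a weakening of it. [cite: CossartJannsenSaito2020, Thm. 1.2]
[cite: Lipman1969, Theorem (4.1) (p. 204) and Theorem (12.1) (ii) (p. 220)] -/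
theorem surfaceTermination_iff_noEternalGenus_of_prints3
    (hCJS : CossartJannsenSaito2020General.{0}) (h41 : Lipman1969_4_1.{0}) (h12ii : Lipman1969_12_1_ii.{0}) :
    SurfaceTermination ↔
      ∀ p : ℕ, p.Prime → ∀ (k K : Type) [Field k] [CharP k p] [Field K] [Algebra k K]
        (O : ValuationSubring K) (A : Subalgebra k K) (hk : ∀ c : k, algebraMap k K c ∈ O), A.FG →
        IsFractionRing ↥A K → A.toSubring ≤ O.toSubring → ringKrullDim ↥A = 2 →
        O ≠ ⊤ → IsDiscreteValuationRing ↥O → residueTrdeg k O hk + 1 = Algebra.trdeg k K →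
        ∀ g m : ℕ, (∀ m' : ℕ, m ≤ m' →
          HasGeometricGenusLE ↥(tower O A (m' + 1)) (g + 1) ∧ ¬ HasGeometricGenusLE ↥(tower O A (m' + 1)) g) →
          False :=
  ⟨noEternalGenus_of_surfaceTermination, surfaceTermination_of_prints3_of_noEternalGenus hCJS h41 h12ii⟩

/-- **`SurfaceTermination` ⟺ (M) modulo the three prints**: the kill test BY NAME is EQUIVALENT to the meet residue
(⇒ fact-free; ⇐ `surfaceTermination_of_prints3_of_meet`). [cite: CossartJannsenSaito2020, Thm. 1.2]
[cite: Lipman1969, Theorem (4.1) (p. 204) and Theorem (12.1) (ii) (p. 220)] -/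
theorem surfaceTermination_iff_meet_of_prints3
    (hCJS : CossartJannsenSaito2020General.{0}) (h41 : Lipman1969_4_1.{0}) (h12ii : Lipman1969_12_1_ii.{0}) :
    SurfaceTermination ↔
      ∀ p : ℕ, p.Prime → ∀ (k K : Type) [Field k] [CharP k p] [Field K] [Algebra k K]
        (O : ValuationSubring K) (A : Subalgebra k K) (hk : ∀ c : k, algebraMap k K c ∈ O), A.FG →
        IsFractionRing ↥A K → A.toSubring ≤ O.toSubring → ringKrullDim ↥A = 2 →
        O ≠ ⊤ → IsDiscreteValuationRing ↥O → residueTrdeg k O hk + 1 = Algebra.trdeg k K →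
        ∀ g m : ℕ, (∀ m' : ℕ, m ≤ m' →
          HasGeometricGenusLE ↥(tower O A (m' + 1)) (g + 1) ∧ ¬ HasGeometricGenusLE ↥(tower O A (m' + 1)) g) →
          (∀ m₁ : ℕ, ∃ i : ℕ, m₁ + 1 ≤ i ∧ ¬ IsRegularLocalRing ↥(tower O A i) ∧
            ¬ HasRationalSingularity ↥(tower O A i) ∧
            ∃ (S : Subalgebra k K) (hTS : tower O A i ≤ S),
              (∀ t ∈ tower O A i, t⁻¹ ∈ S → t⁻¹ ∈ tower O A i) ∧ IsRegularLocalRing ↥S ∧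
              Algebra.EssFiniteType k ↥S ∧
              ¬ (Ideal.map (Subalgebra.inclusion hTS).toRingHom
                  (cohomologyAnnihilator ↥(tower O A i))).IsPrincipal) →
          False :=
  ⟨meet_of_surfaceTermination, surfaceTermination_of_prints3_of_meet hCJS h41 h12ii⟩

end Summit.ResolutionOfSingularities.ResolutionOfSingularities.Theorems.SurfaceTermination.PrintDebtDoors

end
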